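import Literature.NumberTheory.LFunctions.Zhang2022.RepairFrakc12Theta
import Literature.NumberTheory.LFunctions.Zhang2022.Section9ChangeOfVariables

/-!
# Zhang (2022), repair rung F-S1R: OFF-θ₀ FAITHFULNESS of the mollifier-pair block — (8.11)/(8.12) at a general design IS `pairFormR`

Y. Zhang, *Discrete mean estimates and the Landau–Siegel zero*, arXiv:2211.02515v1 [Zhang2022LandauSiegel] —
an unrefereed manuscript under adjudication; **nothing here asserts any of its claims, and nothing here is a
statement about Landau–Siegel zeros.** Repair rung (D-0077), Track K-S1 annex (referee risk «formula-vs-display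
faithfulness OFF θ₀», RULING R3 / ASSIGNMENTS Track R).

The class functionals `frakc1T θ = pairFormR k₁ k₂ ν₁ ν₂ 1 ι₂` and `frakc2T θ = pairFormR k₂ k₃ ν₂ ν₃ ῑ₄ ῑ₃`
(`RepairFrakc12Theta`) are DEFINED as the (8.19)–(8.22)/(9.3)–(9.6)-shaped `z`-integrals with every printed
literal replaced by its formula; `RepairSection9Theta`/`RepairFrakc12Theta` prove they reproduce the printed
constants AT θ₀. This file proves they are what the manuscript's OWN displayed derivation produces AT EVERY
DESIGN: the tree's (8.11)-shaped two-scale functional `Section9ChangeOfVariables.S811g` (general exponents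
`θ_L, θ_S`, general coefficients; `S811g = S812g` by the change of variables `x → Q/x` and `S812g_eq_zform` by
`x = Pᶻ`, both proved for arbitrary profiles and exponents) fed with the main terms of Lemmas 8.2/8.4 at REAL
shift multipliers (`Section8MainTerms.frakf/frakg` at `β_j = ijα`, `β_μ = ikα`, `(β_{j+1},β_{j+2})` the cyclic
complements; `fXR`, `gXR`) and summed with Proposition 7.1's weights `(1/(2α), 2/α, 3/(2α))` equals
`thetaCoeffR k_L k_S ν_L ν_S u_L u_S := |u_L|²b_LL + u_Lū_S b_Y + u_Sū_L b_X + |u_S|²b_SS`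
(`weighted_S811g_eq_thetaCoeffR`, needs only `α log P = π`, `ν_L, ν_S, k_L, k_S ≠ 0`), and
`pairFormR = thetaCoeffR + conj thetaCoeffR` (`pairFormR_eq_thetaCoeffR_add_conj`; (8.7)/(8.23), (9.1)/(9.7):
`Ξ = 2Re Θ₁`). Hence `frakc1T θ`, `frakc2T θ` are, at every `θ`, the `2Re Θ₁` main coefficients of the
manuscript's (8.11)-display for the designs `(H₁₁, H₁₂)` resp. `(H₁₂, H₁₃)` (`frakc1T_faithful`,
`frakc2T_faithful`). The printed-θ₀ instances are `Section8ChangeOfVariables.weighted_sum_S811_main` and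
`Section9ChangeOfVariables.weighted_sum_S911_main`. Pure calculus/algebra; `[cite]` tags name the displays.
-/

noncomputable section

open Complex Real ComplexConjugate Set MeasureTheory intervalIntegral

namespace Literature.NumberTheory.LFunctions.Zhang2022

namespace Repair

/-! ### Lemma 8.2/8.4 main terms at real shift multipliers -/

/-- Lemma 8.2's main term `𝔣_{jμ}(x) = (1 + (β_μ − β_j)log x)x^{β_μ}` at `β_j = ijα`, `β_μ = ikα` (REAL `k`), as a
function of real `x > 0`. [cite: Zhang2022LandauSiegel, Lemma 8.2 p.45] -/
def fXR (j : ℕ) (k α : ℝ) (x : ℝ) : ℂ := frakf ((j : ℂ) * I * α) ((k : ℂ) * I * α) (Real.log x)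

/-- First cyclic complement `b_{j+1}` of `b = (1,2,3)` (`β₄ = β₁, β₅ = β₂`): `(2, 3, 1)`.
[cite: Zhang2022LandauSiegel, §8 before Lemma 8.2 p.45] -/
def bC1 (j : ℕ) : ℝ := if j = 1 then 2 else if j = 2 then 3 else 1

/-- Second cyclic complement `b_{j+2}`: `(3, 1, 2)`. [cite: Zhang2022LandauSiegel, §8 before Lemma 8.2 p.45] -/
def bC2 (j : ℕ) : ℝ := if j = 1 then 3 else if j = 2 then 1 else 2

/-- Lemma 8.4's main term `𝔤_{jμ}(x)` at `(β_{j+1}, β_{j+2}) = (i b_{j+1} α, i b_{j+2} α)`, `β_μ = ikα`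
(REAL `k`), as a function of real `x > 0`. [cite: Zhang2022LandauSiegel, Lemma 8.4 p.46] -/
def gXR (j : ℕ) (k α : ℝ) (x : ℝ) : ℂ :=
  frakg ((bC1 j : ℂ) * I * α) ((bC2 j : ℂ) * I * α) ((k : ℂ) * I * α) (Real.log x)

/-- `b_{j+1}b_{j+2} = N_j` and `b_{j+1}+b_{j+2} = S_j` for `j = 1,2,3`. [cite: Zhang2022LandauSiegel, §8 (8.13)–(8.18)] -/
theorem bC_mul_add {j : ℕ} (hj : j = 1 ∨ j = 2 ∨ j = 3) : bC1 j * bC2 j = bN j ∧ bC1 j + bC2 j = bS j := by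
  rcases hj with rfl | rfl | rfl
  · rw [bN_one, bS_one]; unfold bC1 bC2; norm_num
  · rw [bN_two, bS_two]; unfold bC1 bC2; norm_num
  · rw [bN_three, bS_three]; unfold bC1 bC2; norm_num

variable {α Λ : ℝ}

/-- `𝔣_{j,k}(Pᶻ) = ffT k j z` at real `k` (`α log P = π`) — Lemma 8.2's main term at the main values is
`RepairTheta.ffT`. [cite: Zhang2022LandauSiegel, Lemma 8.2, (8.13)–(8.18) p.49] -/
theorem fXR_exp (h : α * Λ = π) (j : ℕ) (k z : ℝ) : fXR j k α (rexp (Λ * z)) = ffT k j z := by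
  have hπ : (π : ℂ) = (α : ℂ) * Λ := by rw [← Complex.ofReal_mul, h]
  unfold fXR frakf ffT ffR
  rw [Real.log_exp, hπ]; push_cast
  congr 1
  · ring
  · congr 1; ring

/-- `𝔤_{j,k}(Pᶻ) = ghT k j z` at real `k ≠ 0`, `j ∈ {1,2,3}` (`α log P = π`, `α ≠ 0`) — Lemma 8.4's main term at
the main values is `RepairTheta.ghT`. [cite: Zhang2022LandauSiegel, Lemma 8.4, (8.13)–(8.18) p.49] -/
theorem gXR_exp (hα : α ≠ 0) (h : α * Λ = π) {j : ℕ} (hj : j = 1 ∨ j = 2 ∨ j = 3) {k : ℝ} (hk : k ≠ 0)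
    (z : ℝ) : gXR j k α (rexp (Λ * z)) = ghT k j z := by
  have hπ : (π : ℂ) = (α : ℂ) * Λ := by rw [← Complex.ofReal_mul, h]
  have hα' : (α : ℂ) ≠ 0 := by exact_mod_cast hα
  have hk' : (k : ℂ) ≠ 0 := by exact_mod_cast hk
  obtain ⟨hN, hS⟩ := bC_mul_add hj
  unfold gXR frakg ghT ghR
  rw [Real.log_exp, hπ, ← hN, ← hS]; push_cast
  congr 1
  · field_simp
  · congr 1
    · field_simp; ring
    · congr 1; ring

/-- `fXR` is continuous on `(0, ∞)`. [cite: Zhang2022LandauSiegel, Lemma 8.2 p.45] -/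
theorem continuousOn_fXR (j : ℕ) (k α : ℝ) : ContinuousOn (fXR j k α) (Ioi 0) := by
  have hc : Continuous fun L : ℂ => frakf ((j : ℂ) * I * α) ((k : ℂ) * I * α) L := by
    unfold frakf; fun_prop
  exact hc.comp_continuousOn continuousOn_ofReal_log

/-- `gXR` is continuous on `(0, ∞)`. [cite: Zhang2022LandauSiegel, Lemma 8.4 p.46] -/
theorem continuousOn_gXR (j : ℕ) (k α : ℝ) : ContinuousOn (gXR j k α) (Ioi 0) := by
  have hc : Continuous fun L : ℂ =>
      frakg ((bC1 j : ℂ) * I * α) ((bC2 j : ℂ) * I * α) ((k : ℂ) * I * α) L := by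
    unfold frakg; fun_prop
  exact hc.comp_continuousOn continuousOn_ofReal_log

/-! ### The `Θ₁` main coefficient of a pair and its `2Re` -/

/-- The main-order coefficient of `Θ₁(a₁, ā₁)/(𝔞𝔓)` for a two-component design `a₁ = u_Lϰ_L + u_Sϰ_S`
(display before (8.19); display before (9.3)): `|u_L|²b_LL + u_Lū_S b_Y + u_Sū_L b_X + |u_S|²b_SS` with the
`b`'s of `RepairFrakc12Theta`. [cite: Zhang2022LandauSiegel, §8 display before (8.19) p.49; §9 p.51] -/
def thetaCoeffR (kL kS νL νS : ℝ) (uL uS : ℂ) : ℂ :=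
  uL * conj uL * bDiagR kL νL + uL * conj uS * bCrossYR kL kS νL νS
    + uS * conj uL * bCrossXR kL kS νL νS + uS * conj uS * bDiagR kS νS

/-- `Ξ = 2Re Θ₁` ((8.7)/(8.23), (9.1)/(9.7)): the Hermitian pair form is the `Θ₁`-coefficient plus its conjugate.
[cite: Zhang2022LandauSiegel, (8.7), (8.23) p.50; (9.1), (9.7) p.52] -/
theorem pairFormR_eq_thetaCoeffR_add_conj (kL kS νL νS : ℝ) (uL uS : ℂ) :
    pairFormR kL kS νL νS uL uS = thetaCoeffR kL kS νL νS uL uS + conj (thetaCoeffR kL kS νL νS uL uS) := by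
  unfold pairFormR thetaCoeffR cDiagR cCrossR
  simp only [map_add, map_mul, Complex.conj_conj]
  rw [← Complex.mul_conj uL, ← Complex.mul_conj uS]
  ring

/-! ### (8.11) at a general design, summed with Prop 7.1's weights, is the `Θ₁`-coefficient -/

section Faithful

/-- continuity of the `z`-integrands. [cite: Zhang2022LandauSiegel, (8.19)–(8.22) p.49] -/
theorem continuous_ffT_mul_ghT (ka kb : ℝ) (j : ℕ) (s t : ℝ) :
    Continuous fun z : ℝ => ffT ka j (z + s) * ghT kb j (z + t) := by
  unfold ffT ffR ghT ghR; fun_prop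

/-- **OFF-θ₀ faithfulness of the pair block.** For every design (`ν_L, ν_S, k_L, k_S ≠ 0`), every pair of
coefficients and `α log P = π`: the (8.11)-shaped functional `S811g` of the tree — general exponents, the
manuscript's change of variables (8.11) ⇒ (8.12) ⇒ `x = Pᶻ` proved for arbitrary profiles — evaluated on the
main terms of Lemmas 8.2/8.4 at REAL multipliers and summed with `(1/(2α), 2/α, 3/(2α))` (Prop 7.1) is
`thetaCoeffR`. [cite: Zhang2022LandauSiegel, (8.11)–(8.12) p.48, displays after (8.18) p.49] -/
theorem weighted_S811g_eq_thetaCoeffR (hα : 0 < α) (hΛ : 0 < Λ) (h : α * Λ = π) {νL νS kL kS : ℝ}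
    (hL : νL ≠ 0) (hS : νS ≠ 0) (hkL : kL ≠ 0) (hkS : kS ≠ 0) (uL uS : ℂ) :
    1 / (2 * (α : ℂ)) * S811g uL uS (conj uL) (conj uS) (fXR 1 kL α) (fXR 1 kS α) (gXR 1 kL α) (gXR 1 kS α) Λ νL νS
      + 2 / (α : ℂ) * S811g uL uS (conj uL) (conj uS) (fXR 2 kL α) (fXR 2 kS α) (gXR 2 kL α) (gXR 2 kS α) Λ νL νS
      + 3 / (2 * (α : ℂ)) *
        S811g uL uS (conj uL) (conj uS) (fXR 3 kL α) (fXR 3 kS α) (gXR 3 kL α) (gXR 3 kS α) Λ νL νS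
    = thetaCoeffR kL kS νL νS uL uS := by
  have hα0 : α ≠ 0 := hα.ne'
  have hαC : (α : ℂ) ≠ 0 := by exact_mod_cast hα0
  have hΛC : (Λ : ℂ) ≠ 0 := by exact_mod_cast hΛ.ne'
  have hLC : (νL : ℂ) ≠ 0 := by exact_mod_cast hL
  have hSC : (νS : ℂ) ≠ 0 := by exact_mod_cast hS
  have hπ : (π : ℂ) = (α : ℂ) * Λ := by rw [← Complex.ofReal_mul, h]
  have j1 : (1:ℕ) = 1 ∨ (1:ℕ) = 2 ∨ (1:ℕ) = 3 := Or.inl rfl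
  have j2 : (2:ℕ) = 1 ∨ (2:ℕ) = 2 ∨ (2:ℕ) = 3 := Or.inr (Or.inl rfl)
  have j3 : (3:ℕ) = 1 ∨ (3:ℕ) = 2 ∨ (3:ℕ) = 3 := Or.inr (Or.inr rfl)
  rw [S811g_eq_S812g _ _ _ _ (continuousOn_fXR _ _ _) (continuousOn_fXR _ _ _) (continuousOn_gXR _ _ _)
      (continuousOn_gXR _ _ _),
    S811g_eq_S812g _ _ _ _ (continuousOn_fXR _ _ _) (continuousOn_fXR _ _ _) (continuousOn_gXR _ _ _)
      (continuousOn_gXR _ _ _),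
    S811g_eq_S812g _ _ _ _ (continuousOn_fXR _ _ _) (continuousOn_fXR _ _ _) (continuousOn_gXR _ _ _)
      (continuousOn_gXR _ _ _)]
  rw [S812g_eq_zform _ _ _ _ hΛ hL hS (fL := ffT kL 1) (fS := ffT kS 1) (gL := ghT kL 1) (gS := ghT kS 1)
      (fun z => fXR_exp h 1 kL z) (fun z => fXR_exp h 1 kS z)
      (fun z => gXR_exp hα0 h j1 hkL z) (fun z => gXR_exp hα0 h j1 hkS z),
    S812g_eq_zform _ _ _ _ hΛ hL hS (fL := ffT kL 2) (fS := ffT kS 2) (gL := ghT kL 2) (gS := ghT kS 2)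
      (fun z => fXR_exp h 2 kL z) (fun z => fXR_exp h 2 kS z)
      (fun z => gXR_exp hα0 h j2 hkL z) (fun z => gXR_exp hα0 h j2 hkS z),
    S812g_eq_zform _ _ _ _ hΛ hL hS (fL := ffT kL 3) (fS := ffT kS 3) (gL := ghT kL 3) (gS := ghT kS 3)
      (fun z => fXR_exp h 3 kL z) (fun z => fXR_exp h 3 kS z)
      (fun z => gXR_exp hα0 h j3 hkL z) (fun z => gXR_exp hα0 h j3 hkS z)]
  unfold thetaCoeffR bDiagR bCrossYR bCrossXR diagIntegrandR crossYIntegrandR crossXIntegrandR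
  have cD : ∀ (k : ℝ) (j : ℕ), Continuous fun z : ℝ => ffT k j z * ghT k j z := by
    intro k j; simpa using continuous_ffT_mul_ghT k k j 0 0
  have cY : ∀ j : ℕ, Continuous fun z : ℝ => ffT kL j (z + (νL - νS)) * ghT kS j z := by
    intro j; simpa using continuous_ffT_mul_ghT kL kS j (νL - νS) 0
  have cX : ∀ j : ℕ, Continuous fun z : ℝ => ffT kS j z * ghT kL j (z + (νL - νS)) := by
    intro j; simpa using continuous_ffT_mul_ghT kS kL j 0 (νL - νS)
  rw [integral_wsum3 (cD kL 1) (cD kL 2) (cD kL 3), integral_wsum3 (cD kS 1) (cD kS 2) (cD kS 3),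
    integral_wsum3 (cY 1) (cY 2) (cY 3), integral_wsum3 (cX 1) (cX 2) (cX 3)]
  push_cast
  rw [hπ]
  field_simp
  ring

end Faithful

/-! ### The class functionals `𝔠₁(θ)`, `𝔠₂(θ)` are the manuscript's (8.11)/§9 displays at `θ` -/

variable {α Λ : ℝ}

/-- The `Θ₁`-level weighted sum of a two-component design read off the (8.11)-shaped display.
[cite: Zhang2022LandauSiegel, Prop 7.1 p.44, (8.11) p.48] -/
def weightedS811 (α Λ kL kS νL νS : ℝ) (uL uS : ℂ) : ℂ :=
  1 / (2 * (α : ℂ)) * S811g uL uS (conj uL) (conj uS) (fXR 1 kL α) (fXR 1 kS α) (gXR 1 kL α) (gXR 1 kS α) Λ νL νS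
    + 2 / (α : ℂ) * S811g uL uS (conj uL) (conj uS) (fXR 2 kL α) (fXR 2 kS α) (gXR 2 kL α) (gXR 2 kS α) Λ νL νS
    + 3 / (2 * (α : ℂ)) *
      S811g uL uS (conj uL) (conj uS) (fXR 3 kL α) (fXR 3 kS α) (gXR 3 kL α) (gXR 3 kS α) Λ νL νS

/-- **`𝔠₁(θ)` is faithful off θ₀**: for every design with `ν₁, ν₂, k₁, k₂ ≠ 0` (in particular on
`AdmissibleTheta`), `frakc1T θ = W + conj W` where `W` is the (8.11)-display at `θ` for `(H₁₁, H₁₂)` with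
coefficients `(1, ι₂)` ((8.8)), `α log P = π`. [cite: Zhang2022LandauSiegel, (8.7)–(8.8), (8.11), (8.23) pp.47–50] -/
theorem frakc1T_faithful (hα : 0 < α) (hΛ : 0 < Λ) (h : α * Λ = π) {θ : Theta} (h1 : θ.nu1 ≠ 0)
    (h2 : θ.nu2 ≠ 0) (hk1 : θ.k1 ≠ 0) (hk2 : θ.k2 ≠ 0) :
    frakc1T θ = weightedS811 α Λ θ.k1 θ.k2 θ.nu1 θ.nu2 1 θ.iota2
      + conj (weightedS811 α Λ θ.k1 θ.k2 θ.nu1 θ.nu2 1 θ.iota2) := by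
  unfold weightedS811 frakc1T
  rw [weighted_S811g_eq_thetaCoeffR hα hΛ h h1 h2 hk1 hk2, pairFormR_eq_thetaCoeffR_add_conj]

/-- **`𝔠₂(θ)` is faithful off θ₀** (derived prefactor `1/(ν₂ν₃π)`, the reading of record): `frakc2T θ = W + conj W`
where `W` is the §9 display (the (8.11)-shaped functional with `(P₂, P₃)`) at `θ` for `(H₁₂, H₁₃)` with
coefficients `(ῑ₄, ῑ₃)` ((9.2)). [cite: Zhang2022LandauSiegel, (9.1)–(9.2), display p.51, (9.7) p.52] -/
theorem frakc2T_faithful (hα : 0 < α) (hΛ : 0 < Λ) (h : α * Λ = π) {θ : Theta} (h2 : θ.nu2 ≠ 0)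
    (h3 : θ.nu3 ≠ 0) (hk2 : θ.k2 ≠ 0) (hk3 : θ.k3 ≠ 0) :
    frakc2T θ = weightedS811 α Λ θ.k2 θ.k3 θ.nu2 θ.nu3 (conj θ.iota4) (conj θ.iota3)
      + conj (weightedS811 α Λ θ.k2 θ.k3 θ.nu2 θ.nu3 (conj θ.iota4) (conj θ.iota3)) := by
  unfold weightedS811 frakc2T
  rw [weighted_S811g_eq_thetaCoeffR hα hΛ h h2 h3 hk2 hk3, pairFormR_eq_thetaCoeffR_add_conj]

end Repair

end Literature.NumberTheory.LFunctions.Zhang2022
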